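import Literature.MathematicalPhysics.QuantumFieldTheory.QCDTransferMatrix

/-!
# Positivity of the time kernel `A⁻¹ ⊗ P⁺ + A ⊗ P⁻` of the fermionic transfer matrix
(helper for crux stmt-QuantumFields-9737 `QuarksAsStableAction.StableActionBridge`, line `Sketch` —
stub `posDef_timeKernel`)

The one-particle matrix of the fermionic one-step transfer operator of lattice QCD with `r = 1`
Wilson quarks is `M_F = (1 − N) K (1 − N)ᴴ` with the *time kernel*
`K = e^{−γ₄ ln A} = A⁻¹ ⊗ P⁺ + A ⊗ P⁻`, where `P± = ½ (1 ± γ₄)` are the complementary Wilson time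
projections and `A` is the spin-blind slice operator (Smit, *Introduction to Quantum Fields on a
Lattice*, §6.5 (6.91); Lüscher, CMP 54 (1977)).  This file proves: `K` is positive definite whenever
`A` is.

Proof.  `P±` are Hermitian idempotents with `P⁺ P⁻ = 0 = P⁻ P⁺` and `P⁺ + P⁻ = 1`, hence positive
semidefinite; `A` and `A⁻¹` are positive definite; so `A⁻¹ ⊗ₖ P⁺ + A ⊗ₖ P⁻` is positive semidefinite
(`Matrix.PosSemidef.kronecker`, `Matrix.PosSemidef.add`) and it is invertible with the explicit inverse
`A ⊗ₖ P⁺ + A⁻¹ ⊗ₖ P⁻` (the product is `1 ⊗ₖ P⁺ + 1 ⊗ₖ P⁻ = 1 ⊗ₖ 1 = 1`), hence positive definite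
(`Matrix.PosSemidef.posDef_iff_isUnit`).  Finally `sliceKron B Γ` is the Kronecker product `B ⊗ₖ Γ`
reindexed along `((f, x, a), α) ↦ (f, x, a, α)`, and positive definiteness transports along an
injective reindexing (`Matrix.PosDef.submatrix`).  Pure theorem file (no definitions).
-/

noncomputable section

namespace Summit.QuantumFields.QCD.Cruxes.StableActionBridge.Sketch

open scoped ComplexOrder
open Literature.MathematicalPhysics.QuantumFieldTheory Literature.MathematicalPhysics.QuantumLattice

namespace TimeKernelPosDef

open Matrix
open scoped Kronecker

/-! ### The `4 × 4` spin algebra of the Wilson time projections -/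

/-- The scalar `1/2 : ℂ` is self-adjoint. -/
theorem star_one_half : star (1 / 2 : ℂ) = 1 / 2 := by
  rw [Complex.star_def, map_div₀, map_one, map_ofNat]

/-- `P⁺ = ½ (1 + γ₄)` is Hermitian (`γ₄` is). -/
theorem timeProjPlus_isHermitian : timeProjPlus.IsHermitian := by
  unfold timeProjPlus Matrix.IsHermitian
  rw [conjTranspose_smul, conjTranspose_add, conjTranspose_one, (euclideanGamma_isHermitian 0).eq,
    star_one_half]

/-- `P⁻ = ½ (1 - γ₄)` is Hermitian (`γ₄` is). -/
theorem timeProjMinus_isHermitian : timeProjMinus.IsHermitian := by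
  unfold timeProjMinus Matrix.IsHermitian
  rw [conjTranspose_smul, conjTranspose_sub, conjTranspose_one, (euclideanGamma_isHermitian 0).eq,
    star_one_half]

/-- `P⁻ P⁺ = 0` (adjoint of `P⁺ P⁻ = 0`). -/
theorem timeProjMinus_mul_timeProjPlus : timeProjMinus * timeProjPlus = 0 := by
  rw [← timeProjMinus_isHermitian.eq, ← timeProjPlus_isHermitian.eq, ← conjTranspose_mul,
    timeProjPlus_mul_timeProjMinus, conjTranspose_zero]

/-- `P⁺` is idempotent: `P⁺ P⁺ = P⁺ (P⁺ + P⁻) = P⁺`. -/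
theorem timeProjPlus_mul_self : timeProjPlus * timeProjPlus = timeProjPlus := by
  have h := congrArg (fun X => timeProjPlus * X) timeProjPlus_add_timeProjMinus
  simp only [mul_add, timeProjPlus_mul_timeProjMinus, add_zero, mul_one] at h
  exact h

/-- `P⁻` is idempotent: `P⁻ P⁻ = (P⁺ + P⁻) P⁻ = P⁻`. -/
theorem timeProjMinus_mul_self : timeProjMinus * timeProjMinus = timeProjMinus := by
  have h := congrArg (fun X => X * timeProjMinus) timeProjPlus_add_timeProjMinus
  simp only [add_mul, timeProjPlus_mul_timeProjMinus, zero_add, one_mul] at h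
  exact h

/-- `P⁺ = P⁺ᴴ P⁺` is positive semidefinite. -/
theorem timeProjPlus_posSemidef : timeProjPlus.PosSemidef := by
  have h := posSemidef_conjTranspose_mul_self timeProjPlus
  rwa [timeProjPlus_isHermitian.eq, timeProjPlus_mul_self] at h

/-- `P⁻ = P⁻ᴴ P⁻` is positive semidefinite. -/
theorem timeProjMinus_posSemidef : timeProjMinus.PosSemidef := by
  have h := posSemidef_conjTranspose_mul_self timeProjMinus
  rwa [timeProjMinus_isHermitian.eq, timeProjMinus_mul_self] at h

/-! ### The time kernel in Kronecker form -/

variable {n : Type*} [Fintype n] [DecidableEq n]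

/-- The explicit inverse of the time kernel: `(A⁻¹ ⊗ P⁺ + A ⊗ P⁻)(A ⊗ P⁺ + A⁻¹ ⊗ P⁻) = 1` for
invertible `A`. -/
theorem kronKernel_mul_eq_one {A : Matrix n n ℂ} (hA : IsUnit A) :
    (A⁻¹ ⊗ₖ timeProjPlus + A ⊗ₖ timeProjMinus) * (A ⊗ₖ timeProjPlus + A⁻¹ ⊗ₖ timeProjMinus) = 1 := by
  have hdet : IsUnit A.det := (isUnit_iff_isUnit_det A).mp hA
  rw [add_mul, mul_add, mul_add, ← mul_kronecker_mul, ← mul_kronecker_mul, ← mul_kronecker_mul,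
    ← mul_kronecker_mul, nonsing_inv_mul A hdet, mul_nonsing_inv A hdet, timeProjPlus_mul_self,
    timeProjPlus_mul_timeProjMinus, timeProjMinus_mul_timeProjPlus, timeProjMinus_mul_self,
    kronecker_zero, kronecker_zero, add_zero, zero_add, ← kronecker_add,
    timeProjPlus_add_timeProjMinus, one_kronecker_one]

/-- The time kernel `A⁻¹ ⊗ P⁺ + A ⊗ P⁻` is invertible for invertible `A`. -/
theorem kronKernel_isUnit {A : Matrix n n ℂ} (hA : IsUnit A) :
    IsUnit (A⁻¹ ⊗ₖ timeProjPlus + A ⊗ₖ timeProjMinus) :=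
  IsUnit.of_mul_eq_one _ (kronKernel_mul_eq_one hA)

/-- The time kernel `A⁻¹ ⊗ P⁺ + A ⊗ P⁻` is positive semidefinite for positive definite `A`. -/
theorem kronKernel_posSemidef {A : Matrix n n ℂ} (hA : A.PosDef) :
    (A⁻¹ ⊗ₖ timeProjPlus + A ⊗ₖ timeProjMinus).PosSemidef :=
  (hA.inv.posSemidef.kronecker timeProjPlus_posSemidef).add
    (hA.posSemidef.kronecker timeProjMinus_posSemidef)

/-- **Lüscher positivity of the time kernel, Kronecker form**: `A⁻¹ ⊗ P⁺ + A ⊗ P⁻` is positive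
definite for positive definite `A`. -/
theorem kronKernel_posDef {A : Matrix n n ℂ} (hA : A.PosDef) :
    (A⁻¹ ⊗ₖ timeProjPlus + A ⊗ₖ timeProjMinus).PosDef :=
  (kronKernel_posSemidef hA).posDef_iff_isUnit.mpr (kronKernel_isUnit hA.isUnit)

/-! ### Transport to the slice quark modes -/

variable {Nf S : ℕ}

/-- `sliceKron A P⁺ + sliceKron B P⁻` is `A ⊗ₖ P⁺ + B ⊗ₖ P⁻` reindexed along
`(f, x, a, α) ↦ ((f, x, a), α)`. -/
theorem sliceKernel_eq_submatrix (A B : Matrix (SliceColourVar Nf S) (SliceColourVar Nf S) ℂ) :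
    sliceKron A timeProjPlus + sliceKron B timeProjMinus =
      (A ⊗ₖ timeProjPlus + B ⊗ₖ timeProjMinus).submatrix
        (fun q : SliceQuarkVar Nf S => ((q.1, q.2.1, q.2.2.1), q.2.2.2))
        (fun q : SliceQuarkVar Nf S => ((q.1, q.2.1, q.2.2.1), q.2.2.2)) := by
  ext p q
  rfl

/-- The reindexing `(f, x, a, α) ↦ ((f, x, a), α)` is injective. -/
theorem toProd_injective :
    Function.Injective (fun q : SliceQuarkVar Nf S => ((q.1, q.2.1, q.2.2.1), q.2.2.2)) := by
  rintro ⟨f, x, a, α⟩ ⟨f', x', a', α'⟩ h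
  simp only [Prod.mk.injEq] at h
  obtain ⟨⟨rfl, rfl, rfl⟩, rfl⟩ := h
  rfl

end TimeKernelPosDef

/-- **Lüscher positivity of the time kernel** (Smit, *Introduction to Quantum Fields on a Lattice*,
§6.5 (6.91); Lüscher 1977): for a positive definite spin-blind slice operator `A`, the time kernel
`e^{−γ₄ ln A} = A⁻¹ ⊗ P⁺ + A ⊗ P⁻` of the fermionic transfer matrix of `r = 1` Wilson quarks is
positive definite. -/
theorem posDef_timeKernel :
    ∀ (Nf S : ℕ) [NeZero S] (A : Matrix (SliceColourVar Nf S) (SliceColourVar Nf S) ℂ), A.PosDef →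
      (sliceKron A⁻¹ timeProjPlus + sliceKron A timeProjMinus).PosDef := by
  intro Nf S _ A hA
  rw [TimeKernelPosDef.sliceKernel_eq_submatrix]
  exact (TimeKernelPosDef.kronKernel_posDef hA).submatrix TimeKernelPosDef.toProd_injective

end Summit.QuantumFields.QCD.Cruxes.StableActionBridge.Sketch

end
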